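import Mathlib
import HarnessLib
import Summits.Ventures.LatticeQCDFlow.Scaling.IdentityFlowAcceptanceDiagonalLimit
import Summits.Ventures.LatticeQCDFlow.Scaling.TiltAcceptanceCouplingMonotone
import Summits.Ventures.LatticeQCDFlow.Scaling.TiltTransferDiagonalLimit

/-!
# LatticeQCDFlow / Scaling — THE COUPLING WINDOW OF THE UNTRAINED FACTORISED SAMPLER IS EXACTLY
# `Θ(V^{−1/2})`: `acc_V(β_V) → 0` if `β_V√V → ∞`, `→ 1` if `β_V√V → 0`, `→ erfc(cσ/2)` on `β_V√V → c`

HONEST FRAMING: exact (Metropolis-corrected) sampling algorithms for lattice gauge theory;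
figures of merit are autocorrelation/cost numbers at stated couplings and volumes; no
continuum-physics claim.

Venture `LatticeQCDFlow` (cell pub-lqcd), topic `Scaling`; FANOUT row 3 (`s0-u1-a`, S0-B
implementation A, GEN-19).  NEW WORK of the cell (assembly of row 3's GEN-17 (A)
`Scaling/TiltAcceptanceCouplingMonotone` — acceptance antitone in `β ≥ 0` — with the diagonal scaling
limit `Scaling/IdentityFlowAcceptanceDiagonalLimit`); NO definition is introduced; nothing is cited.

## The statement

Bounded centred block statistic `g` (`|g| ≤ K`, `∫ g dν = 0`, `σ² = Var g > 0`), the untrained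
exact sampler of `V` independent blocks (proposal `ν^{⊗V}`, weight `e^{βΣg}`), non-negative couplings
`β_V`:
* **`tiltPi_meanAccept_tendsto_zero`** — `β_V·√V → ∞` ⇒ `acc_V(β_V) → 0` (then `β_V ≥ 0` eventually);
* **`tiltPi_meanAccept_tendsto_one`** — `β_V·√V → 0` ⇒ `acc_V(β_V) → 1`;
* (the diagonal `β_V√V = c` is `tiltPi_meanAccept_diag_tendsto_erfc`: `→ erfc(cσ/2)`);
* `…_of_bounded` — the same for a non-centred bounded statistic; **`tiltedPi_transfer_tendsto_zero`
  / `…_one`** — the TRANSFER WINDOW of a perfectly trained factorised flow (proposal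
  `(ν.tilted β₀g)^{⊗V}`, offsets `δ_V = β − β₀ ≥ 0`): `δ_V√V → ∞ ⇒ acc → 0`, `δ_V√V → 0 ⇒ acc → 1` —
  a trained flow is reusable exactly within `|β − β₀| = O(V^{−1/2})` (profile
  `erfc(|c|σ(β₀)/2)`, `Scaling/TiltTransferDiagonalLimit`).

So a fixed acceptance is kept exactly on couplings `β = Θ(V^{−1/2})` — the untrained sampler's useful
window shrinks like the inverse square root of the volume, with the `erfc` profile across it.  Tools:
`erfcProfile_tendsto_zero` / `erfcProfile_tendsto_one` (the limits of `(2/√π)∫_{x}^∞ e^{−u²}du` at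
`∞` and `0⁺`) and the sandwich `0 ≤ acc ≤ 1`.

NOT CLAIMED: negative couplings (symmetric by `g ↦ −g`); rates; the torus; any value at the cell's
`(β, L)`; nothing re-scored.
-/

noncomputable section

namespace Summit.Ventures.LatticeQCDFlow.Theory2

open MeasureTheory ProbabilityTheory Filter Finset Real Set
open scoped Topology NNReal

/-! ## §1 The `erfc` profile at its two ends -/

section Profile

/-- The Gaussian tail integrand is integrable on every half-line. [folklore] -/
theorem integrableOn_exp_neg_sq_Ioi (x : ℝ) : IntegrableOn (fun u : ℝ => Real.exp (-u ^ 2)) (Ioi x) := by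
  have h := (integrable_exp_neg_mul_sq zero_lt_one).integrableOn (s := Ioi x)
  refine h.congr_fun (fun u _ => by simp) measurableSet_Ioi

/-- `(2/√π)∫_x^∞ e^{−u²}du → 0` as `x → ∞` (comparison with `e^{−u}` for `u ≥ 1`). [folklore] -/
theorem erfcProfile_tendsto_zero :
    Tendsto (fun x : ℝ => 2 / Real.sqrt Real.pi * ∫ u in Ioi x, Real.exp (-u ^ 2)) atTop (𝓝 0) := by
  have hbound : ∀ x : ℝ, 1 ≤ x → ∫ u in Ioi x, Real.exp (-u ^ 2) ≤ Real.exp (-x) := by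
    intro x hx
    calc ∫ u in Ioi x, Real.exp (-u ^ 2) ≤ ∫ u in Ioi x, Real.exp (-u) := by
          refine setIntegral_mono_on (integrableOn_exp_neg_sq_Ioi x) (integrableOn_exp_neg_Ioi x)
            measurableSet_Ioi fun u hu => ?_
          exact Real.exp_le_exp.2 (by nlinarith [show 1 ≤ u from hx.trans (le_of_lt hu)])
      _ = Real.exp (-x) := integral_exp_neg_Ioi x
  have hnonneg : ∀ x : ℝ, 0 ≤ ∫ u in Ioi x, Real.exp (-u ^ 2) := fun x =>
    setIntegral_nonneg measurableSet_Ioi fun u _ => (Real.exp_pos _).le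
  have h0 : Tendsto (fun x : ℝ => ∫ u in Ioi x, Real.exp (-u ^ 2)) atTop (𝓝 0) := by
    refine tendsto_of_tendsto_of_tendsto_of_le_of_le' tendsto_const_nhds
      Real.tendsto_exp_neg_atTop_nhds_zero (Filter.Eventually.of_forall hnonneg) ?_
    exact (eventually_ge_atTop 1).mono fun x hx => hbound x hx
  simpa using h0.const_mul (2 / Real.sqrt Real.pi)

/-- `(2/√π)∫_x^∞ e^{−u²}du → 1` as `x → 0⁺`. [folklore] -/
theorem erfcProfile_tendsto_one :
    Tendsto (fun x : ℝ => 2 / Real.sqrt Real.pi * ∫ u in Ioi x, Real.exp (-u ^ 2)) (𝓝[>] 0) (𝓝 1) := by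
  -- `∫_{Ioi 0} e^{−u²} = √π/2`
  have hI0 : ∫ u in Ioi (0 : ℝ), Real.exp (-u ^ 2) = Real.sqrt Real.pi / 2 := by
    have := integral_gaussian_Ioi 1
    simp only [neg_mul, one_mul, div_one] at this
    rw [← this]
  -- splitting `Ioi 0 = Ioc 0 x ∪ Ioi x`: `|∫_{Ioi x} − ∫_{Ioi 0}| ≤ x`
  have hsplit : ∀ x : ℝ, 0 < x →
      ∫ u in Ioi (0 : ℝ), Real.exp (-u ^ 2) = (∫ u in Ioc (0 : ℝ) x, Real.exp (-u ^ 2))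
        + ∫ u in Ioi x, Real.exp (-u ^ 2) := by
    intro x hx
    rw [← Set.Ioc_union_Ioi_eq_Ioi hx.le, setIntegral_union (Set.Ioc_disjoint_Ioi le_rfl)
      measurableSet_Ioi ((integrableOn_exp_neg_sq_Ioi 0).mono_set Set.Ioc_subset_Ioi_self)
      (integrableOn_exp_neg_sq_Ioi x)]
  have hmid : ∀ x : ℝ, 0 < x → 0 ≤ ∫ u in Ioc (0 : ℝ) x, Real.exp (-u ^ 2)
      ∧ ∫ u in Ioc (0 : ℝ) x, Real.exp (-u ^ 2) ≤ x := by
    intro x hx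
    refine ⟨setIntegral_nonneg measurableSet_Ioc fun u _ => (Real.exp_pos _).le, ?_⟩
    calc ∫ u in Ioc (0 : ℝ) x, Real.exp (-u ^ 2) ≤ ∫ u in Ioc (0 : ℝ) x, (1 : ℝ) := by
          refine setIntegral_mono_on ((integrableOn_exp_neg_sq_Ioi 0).mono_set Set.Ioc_subset_Ioi_self)
            (by simp) measurableSet_Ioc fun u _ => ?_
          rw [Real.exp_le_one_iff]; nlinarith
      _ = x := by simp [hx.le]
  have hlim : Tendsto (fun x : ℝ => ∫ u in Ioi x, Real.exp (-u ^ 2)) (𝓝[>] 0)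
      (𝓝 (Real.sqrt Real.pi / 2)) := by
    rw [← hI0, Metric.tendsto_nhdsWithin_nhds]
    intro ε hε
    refine ⟨ε, hε, fun x hx hdist => ?_⟩
    have hx0 : 0 < x := hx
    rw [Real.dist_eq, hsplit x hx0]
    obtain ⟨h1, h2⟩ := hmid x hx0
    have : |x| < ε := by simpa [Real.dist_eq] using hdist
    rw [show (∫ u in Ioi x, Real.exp (-u ^ 2)) - ((∫ u in Ioc (0 : ℝ) x, Real.exp (-u ^ 2))
        + ∫ u in Ioi x, Real.exp (-u ^ 2)) = -(∫ u in Ioc (0 : ℝ) x, Real.exp (-u ^ 2)) by ring,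
      abs_neg, abs_of_nonneg h1]
    exact h2.trans_lt (lt_of_abs_lt this)
  have := hlim.const_mul (2 / Real.sqrt Real.pi)
  have e : 2 / Real.sqrt Real.pi * (Real.sqrt Real.pi / 2) = 1 := by
    have : 0 < Real.sqrt Real.pi := Real.sqrt_pos.2 Real.pi_pos
    field_simp
  rw [e] at this
  exact this

end Profile

/-! ## §2 The window theorems -/

section Window

open Literature.Probability.Distributions.PseudoMarginalNoise

variable {X : Type*} {mX : MeasurableSpace X} {ν : Measure X} [IsProbabilityMeasure ν] {g : X → ℝ}

/-- The acceptance functional of the untrained factorised sampler is ANTITONE in `β ≥ 0`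
(row 3's GEN-17 (A) `tiltIMH_meanAccept_le_of_le` with model density `q ≡ 1` on `ν^{⊗n}`). [ours] -/
theorem tiltPi_meanAccept_le_of_le (hgm : Measurable g) {K : ℝ} (hK : ∀ x, |g x| ≤ K) (n : ℕ)
    {β β' : ℝ} (hβ : 0 ≤ β) (hββ' : β ≤ β') :
    (∫ x, ∫ y, min (Real.exp (β' * ∑ i, g (x i))) (Real.exp (β' * ∑ i, g (y i)))
          ∂(Measure.pi fun _ : Fin n => ν) ∂(Measure.pi fun _ : Fin n => ν))
        / ∫ x, Real.exp (β' * ∑ i, g (x i)) ∂(Measure.pi fun _ : Fin n => ν)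
      ≤ (∫ x, ∫ y, min (Real.exp (β * ∑ i, g (x i))) (Real.exp (β * ∑ i, g (y i)))
          ∂(Measure.pi fun _ : Fin n => ν) ∂(Measure.pi fun _ : Fin n => ν))
        / ∫ x, Real.exp (β * ∑ i, g (x i)) ∂(Measure.pi fun _ : Fin n => ν) := by
  have hTm : Measurable fun y : Fin n → X => ∑ i, g (y i) :=
    Finset.measurable_sum _ fun i _ => hgm.comp (measurable_pi_apply i)
  have hTb : ∀ y : Fin n → X, |∑ i, g (y i)| ≤ n * K := fun y => by
    calc |∑ i, g (y i)| ≤ ∑ i, |g (y i)| := Finset.abs_sum_le_sum_abs _ _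
      _ ≤ ∑ _i : Fin n, K := Finset.sum_le_sum fun i _ => hK _
      _ = n * K := by simp
  have hb : ∀ᵐ y ∂(Measure.pi fun _ : Fin n => ν), (∑ i, g (y i)) ∈ Set.Icc (-(n * K)) (n * K) :=
    ae_of_all _ fun y => abs_le.1 (hTb y)
  have hint : ∀ γ : ℝ, Integrable (fun y : Fin n → X => (1 : ℝ) * Real.exp (γ * ∑ i, g (y i)))
      (Measure.pi fun _ : Fin n => ν) := fun γ => by
    simpa using integrable_exp_mul_of_mem_Icc hTm.aemeasurable hb (t := γ)
  have hpos : ∀ γ : ℝ, 0 < ∫ y, (1 : ℝ) * Real.exp (γ * ∑ i, g (y i)) ∂(Measure.pi fun _ : Fin n => ν) :=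
    fun γ => by simpa using integral_exp_pos (by simpa using hint γ)
  have h := tiltIMH_meanAccept_le_of_le (ν := Measure.pi fun _ : Fin n => ν) (q := fun _ => (1 : ℝ))
    (T := fun y => ∑ i, g (y i)) (fun _ => zero_le_one) measurable_const hTm (integrable_const _)
    hβ hββ' (hint β) (hint β') (hpos β) (hpos β')
  simpa using h

/-- `0 ≤ acc ≤ 1` for the acceptance functional of the untrained factorised sampler. [ours] -/
theorem tiltPi_meanAccept_mem_Icc (hgm : Measurable g) {K : ℝ} (hK : ∀ x, |g x| ≤ K) (n : ℕ) (β : ℝ) :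
    (∫ x, ∫ y, min (Real.exp (β * ∑ i, g (x i))) (Real.exp (β * ∑ i, g (y i)))
          ∂(Measure.pi fun _ : Fin n => ν) ∂(Measure.pi fun _ : Fin n => ν))
        / ∫ x, Real.exp (β * ∑ i, g (x i)) ∂(Measure.pi fun _ : Fin n => ν) ∈ Set.Icc (0 : ℝ) 1 := by
  set P := Measure.pi fun _ : Fin n => ν with hP
  have hTm : Measurable fun y : Fin n → X => ∑ i, g (y i) :=
    Finset.measurable_sum _ fun i _ => hgm.comp (measurable_pi_apply i)
  have hTb : ∀ y : Fin n → X, |∑ i, g (y i)| ≤ n * K := fun y => by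
    calc |∑ i, g (y i)| ≤ ∑ i, |g (y i)| := Finset.abs_sum_le_sum_abs _ _
      _ ≤ ∑ _i : Fin n, K := Finset.sum_le_sum fun i _ => hK _
      _ = n * K := by simp
  have hb : ∀ᵐ y ∂P, (∑ i, g (y i)) ∈ Set.Icc (-(n * K)) (n * K) := ae_of_all _ fun y => abs_le.1 (hTb y)
  have hint : Integrable (fun y : Fin n → X => Real.exp (β * ∑ i, g (y i))) P :=
    integrable_exp_mul_of_mem_Icc hTm.aemeasurable hb
  have hZ : 0 < ∫ y, Real.exp (β * ∑ i, g (y i)) ∂P := integral_exp_pos hint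
  have hnum0 : 0 ≤ ∫ x, ∫ y, min (Real.exp (β * ∑ i, g (x i))) (Real.exp (β * ∑ i, g (y i))) ∂P ∂P :=
    integral_nonneg fun x => integral_nonneg fun y => (lt_min (Real.exp_pos _) (Real.exp_pos _)).le
  have hnum1 : ∫ x, ∫ y, min (Real.exp (β * ∑ i, g (x i))) (Real.exp (β * ∑ i, g (y i))) ∂P ∂P
      ≤ ∫ x, Real.exp (β * ∑ i, g (x i)) ∂P := by
    refine integral_mono_of_nonneg (ae_of_all _ fun x => integral_nonneg fun y =>
      (lt_min (Real.exp_pos _) (Real.exp_pos _)).le) hint (ae_of_all _ fun x => ?_)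
    calc ∫ y, min (Real.exp (β * ∑ i, g (x i))) (Real.exp (β * ∑ i, g (y i))) ∂P
        ≤ ∫ _y, Real.exp (β * ∑ i, g (x i)) ∂P := by
          refine integral_mono_of_nonneg (ae_of_all _ fun y => (lt_min (Real.exp_pos _) (Real.exp_pos _)).le)
            (integrable_const _) (ae_of_all _ fun y => min_le_left _ _)
      _ = Real.exp (β * ∑ i, g (x i)) := by simp
  exact ⟨div_nonneg hnum0 hZ.le, (div_le_one hZ).2 hnum1⟩

/-- **ABOVE THE WINDOW**: `β_n ≥ 0` with `β_n√n → ∞` ⇒ `acc_n(β_n) → 0`. [ours] -/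
theorem tiltPi_meanAccept_tendsto_zero (hgm : Measurable g) {K : ℝ} (hK : ∀ x, |g x| ≤ K)
    (h0 : ∫ x, g x ∂ν = 0) (hσ : Var[g; ν] ≠ 0) {β : ℕ → ℝ}
    (hβ : Tendsto (fun n : ℕ => β n * Real.sqrt n) atTop atTop) :
    Tendsto (fun n : ℕ =>
        (∫ x, ∫ y, min (Real.exp (β n * ∑ i, g (x i))) (Real.exp (β n * ∑ i, g (y i)))
            ∂(Measure.pi fun _ : Fin n => ν) ∂(Measure.pi fun _ : Fin n => ν))
          / ∫ x, Real.exp (β n * ∑ i, g (x i)) ∂(Measure.pi fun _ : Fin n => ν))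
      atTop (𝓝 0) := by
  have hv : 0 < Var[g; ν] := lt_of_le_of_ne (variance_nonneg _ _) (Ne.symm hσ)
  rw [tendsto_order]
  refine ⟨fun a ha => Filter.Eventually.of_forall fun n =>
    ha.trans_le (tiltPi_meanAccept_mem_Icc hgm hK n (β n)).1, fun b hb => ?_⟩
  -- choose `c ≥ 1` with `erfc(cσ/2) < b`
  have hprof : Tendsto (fun c : ℝ => 2 / Real.sqrt Real.pi
      * ∫ u in Ioi (Real.sqrt (c ^ 2 * Var[g; ν]) / 2), Real.exp (-u ^ 2)) atTop (𝓝 0) := by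
    refine erfcProfile_tendsto_zero.comp ?_
    have h1 : Tendsto (fun c : ℝ => c * Real.sqrt (Var[g; ν]) / 2) atTop atTop :=
      (Tendsto.atTop_mul_const (Real.sqrt_pos.2 hv) tendsto_id).atTop_div_const two_pos
    refine h1.congr' ?_
    filter_upwards [eventually_ge_atTop 0] with c hc
    rw [Real.sqrt_mul' _ (variance_nonneg _ _), Real.sqrt_sq hc]
  obtain ⟨c, hc1, hcb⟩ : ∃ c : ℝ, 1 ≤ c ∧ 2 / Real.sqrt Real.pi
      * ∫ u in Ioi (Real.sqrt (c ^ 2 * Var[g; ν]) / 2), Real.exp (-u ^ 2) < b := by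
    have := ((tendsto_order.1 hprof).2 b hb).and (eventually_ge_atTop 1)
    obtain ⟨c, hc, hc'⟩ := this.exists
    exact ⟨c, hc', hc⟩
  have hc0 : c ≠ 0 := by linarith
  have hdiag := tiltPi_meanAccept_diag_tendsto_erfc (ν := ν) hgm hK h0 hc0 hσ
  have hev1 : ∀ᶠ n : ℕ in atTop, (∫ x, ∫ y, min (Real.exp (c / Real.sqrt n * ∑ i, g (x i)))
        (Real.exp (c / Real.sqrt n * ∑ i, g (y i)))
        ∂(Measure.pi fun _ : Fin n => ν) ∂(Measure.pi fun _ : Fin n => ν))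
      / ∫ x, Real.exp (c / Real.sqrt n * ∑ i, g (x i)) ∂(Measure.pi fun _ : Fin n => ν) < b :=
    (tendsto_order.1 hdiag).2 b hcb
  have hev2 : ∀ᶠ n : ℕ in atTop, c / Real.sqrt n ≤ β n := by
    filter_upwards [(tendsto_atTop.1 hβ) c, eventually_gt_atTop 0] with n hn hn0
    have hsn : 0 < Real.sqrt n := Real.sqrt_pos.2 (Nat.cast_pos.2 hn0)
    rw [div_le_iff₀ hsn]; exact hn
  filter_upwards [hev1, hev2, eventually_gt_atTop 0] with n h1 h2 hn0
  have hcn : 0 ≤ c / Real.sqrt n := div_nonneg (by linarith) (Real.sqrt_nonneg _)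
  exact (tiltPi_meanAccept_le_of_le hgm hK n hcn h2).trans_lt h1

/-- **BELOW THE WINDOW**: `β_n ≥ 0` with `β_n√n → 0` ⇒ `acc_n(β_n) → 1`. [ours] -/
theorem tiltPi_meanAccept_tendsto_one (hgm : Measurable g) {K : ℝ} (hK : ∀ x, |g x| ≤ K)
    (h0 : ∫ x, g x ∂ν = 0) (hσ : Var[g; ν] ≠ 0) {β : ℕ → ℝ} (hβ0 : ∀ n, 0 ≤ β n)
    (hβ : Tendsto (fun n : ℕ => β n * Real.sqrt n) atTop (𝓝 0)) :
    Tendsto (fun n : ℕ =>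
        (∫ x, ∫ y, min (Real.exp (β n * ∑ i, g (x i))) (Real.exp (β n * ∑ i, g (y i)))
            ∂(Measure.pi fun _ : Fin n => ν) ∂(Measure.pi fun _ : Fin n => ν))
          / ∫ x, Real.exp (β n * ∑ i, g (x i)) ∂(Measure.pi fun _ : Fin n => ν))
      atTop (𝓝 1) := by
  have hv : 0 < Var[g; ν] := lt_of_le_of_ne (variance_nonneg _ _) (Ne.symm hσ)
  rw [tendsto_order]
  refine ⟨fun a ha => ?_, fun b hb => Filter.Eventually.of_forall fun n =>
    (tiltPi_meanAccept_mem_Icc hgm hK n (β n)).2.trans_lt hb⟩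
  -- choose `c > 0` with `erfc(cσ/2) > a`
  have hprof : Tendsto (fun c : ℝ => 2 / Real.sqrt Real.pi
      * ∫ u in Ioi (Real.sqrt (c ^ 2 * Var[g; ν]) / 2), Real.exp (-u ^ 2)) (𝓝[>] 0) (𝓝 1) := by
    refine erfcProfile_tendsto_one.comp ?_
    have h1 : Tendsto (fun c : ℝ => c * Real.sqrt (Var[g; ν]) / 2) (𝓝[>] 0) (𝓝[>] 0) := by
      refine tendsto_nhdsWithin_iff.2 ⟨?_, ?_⟩
      · have : Tendsto (fun c : ℝ => c * Real.sqrt (Var[g; ν]) / 2) (𝓝 0) (𝓝 (0 * Real.sqrt (Var[g; ν]) / 2)) :=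
          ((continuous_id.mul continuous_const).div_const _).tendsto 0
        simp only [zero_mul, zero_div] at this
        exact this.mono_left nhdsWithin_le_nhds
      · filter_upwards [self_mem_nhdsWithin] with c hc
        exact div_pos (mul_pos hc (Real.sqrt_pos.2 hv)) two_pos
    refine h1.congr' ?_
    filter_upwards [self_mem_nhdsWithin] with c hc
    rw [Real.sqrt_mul' _ (variance_nonneg _ _), Real.sqrt_sq (le_of_lt hc)]
  obtain ⟨c, hc0, hca⟩ : ∃ c : ℝ, 0 < c ∧ a < 2 / Real.sqrt Real.pi
      * ∫ u in Ioi (Real.sqrt (c ^ 2 * Var[g; ν]) / 2), Real.exp (-u ^ 2) := by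
    have h := ((tendsto_order.1 hprof).1 a ha).and self_mem_nhdsWithin
    obtain ⟨c, hc, hc'⟩ := h.exists
    exact ⟨c, hc', hc⟩
  have hdiag := tiltPi_meanAccept_diag_tendsto_erfc (ν := ν) hgm hK h0 hc0.ne' hσ
  have hev1 : ∀ᶠ n : ℕ in atTop, a < (∫ x, ∫ y, min (Real.exp (c / Real.sqrt n * ∑ i, g (x i)))
        (Real.exp (c / Real.sqrt n * ∑ i, g (y i)))
        ∂(Measure.pi fun _ : Fin n => ν) ∂(Measure.pi fun _ : Fin n => ν))
      / ∫ x, Real.exp (c / Real.sqrt n * ∑ i, g (x i)) ∂(Measure.pi fun _ : Fin n => ν) :=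
    (tendsto_order.1 hdiag).1 a hca
  have hev2 : ∀ᶠ n : ℕ in atTop, β n ≤ c / Real.sqrt n := by
    have := (Metric.tendsto_nhds.1 hβ) c hc0
    filter_upwards [this, eventually_gt_atTop 0] with n hn hn0
    have hsn : 0 < Real.sqrt n := Real.sqrt_pos.2 (Nat.cast_pos.2 hn0)
    rw [le_div_iff₀ hsn]
    have : |β n * Real.sqrt n| < c := by simpa [Real.dist_eq] using hn
    exact (le_abs_self _).trans this.le
  filter_upwards [hev1, hev2] with n h1 h2
  exact h1.trans_le (tiltPi_meanAccept_le_of_le hgm hK n (hβ0 n) h2)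

end Window

/-! ## §3 Non-centred statistics and the transfer window of a perfectly trained factorised flow -/

section TransferWindow

open Literature.Probability.Distributions.PseudoMarginalNoise

variable {X : Type*} {mX : MeasurableSpace X} {ν : Measure X} [IsProbabilityMeasure ν] {g : X → ℝ}

/-- **Above the window, non-centred statistic**: `β_n√n → ∞` ⇒ `acc_n(β_n) → 0` for any bounded `g`
with `Var g ≠ 0` (shift invariance of the acceptance functional, `Scaling/TiltTransferDiagonalLimit`).
[ours] -/
theorem tiltPi_meanAccept_tendsto_zero_of_bounded (hgm : Measurable g) {K : ℝ} (hK : ∀ x, |g x| ≤ K)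
    (hσ : Var[g; ν] ≠ 0) {β : ℕ → ℝ} (hβ : Tendsto (fun n : ℕ => β n * Real.sqrt n) atTop atTop) :
    Tendsto (fun n : ℕ =>
        (∫ x, ∫ y, min (Real.exp (β n * ∑ i, g (x i))) (Real.exp (β n * ∑ i, g (y i)))
            ∂(Measure.pi fun _ : Fin n => ν) ∂(Measure.pi fun _ : Fin n => ν))
          / ∫ x, Real.exp (β n * ∑ i, g (x i)) ∂(Measure.pi fun _ : Fin n => ν))
      atTop (𝓝 0) := by
  set m : ℝ := ∫ x, g x ∂ν with hm
  have hgb : ∀ᵐ x ∂ν, g x ∈ Set.Icc (-K) K := ae_of_all _ fun x => abs_le.1 (hK x)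
  have hgi : Integrable g ν := Integrable.of_mem_Icc (-K) K hgm.aemeasurable hgb
  have hmK : |m| ≤ K := by
    refine (abs_integral_le_integral_abs).trans ?_
    calc ∫ x, |g x| ∂ν ≤ ∫ _x, K ∂ν := integral_mono hgi.abs (integrable_const K) fun x => hK x
      _ = K := by simp
  have hK' : ∀ x, |g x - m| ≤ 2 * K := fun x => by
    calc |g x - m| ≤ |g x| + |m| := abs_sub _ _
      _ ≤ K + K := add_le_add (hK x) hmK
      _ = 2 * K := by ring
  have h0' : ∫ x, (g x - m) ∂ν = 0 := by
    rw [integral_sub hgi (integrable_const m), integral_const]; simp [hm]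
  have hvar : Var[fun x => g x - m; ν] = Var[g; ν] := by
    simp_rw [sub_eq_add_neg]; exact variance_add_const hgi.aestronglyMeasurable (-m)
  have h := tiltPi_meanAccept_tendsto_zero (ν := ν) (hgm.sub_const m) hK' h0' (by rwa [hvar]) hβ
  refine h.congr fun n => ?_
  exact tiltPi_meanAccept_sub_const m (β n) n

/-- **Below the window, non-centred statistic**: `β_n ≥ 0`, `β_n√n → 0` ⇒ `acc_n(β_n) → 1`. [ours] -/
theorem tiltPi_meanAccept_tendsto_one_of_bounded (hgm : Measurable g) {K : ℝ} (hK : ∀ x, |g x| ≤ K)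
    (hσ : Var[g; ν] ≠ 0) {β : ℕ → ℝ} (hβ0 : ∀ n, 0 ≤ β n)
    (hβ : Tendsto (fun n : ℕ => β n * Real.sqrt n) atTop (𝓝 0)) :
    Tendsto (fun n : ℕ =>
        (∫ x, ∫ y, min (Real.exp (β n * ∑ i, g (x i))) (Real.exp (β n * ∑ i, g (y i)))
            ∂(Measure.pi fun _ : Fin n => ν) ∂(Measure.pi fun _ : Fin n => ν))
          / ∫ x, Real.exp (β n * ∑ i, g (x i)) ∂(Measure.pi fun _ : Fin n => ν))
      atTop (𝓝 1) := by
  set m : ℝ := ∫ x, g x ∂ν with hm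
  have hgb : ∀ᵐ x ∂ν, g x ∈ Set.Icc (-K) K := ae_of_all _ fun x => abs_le.1 (hK x)
  have hgi : Integrable g ν := Integrable.of_mem_Icc (-K) K hgm.aemeasurable hgb
  have hmK : |m| ≤ K := by
    refine (abs_integral_le_integral_abs).trans ?_
    calc ∫ x, |g x| ∂ν ≤ ∫ _x, K ∂ν := integral_mono hgi.abs (integrable_const K) fun x => hK x
      _ = K := by simp
  have hK' : ∀ x, |g x - m| ≤ 2 * K := fun x => by
    calc |g x - m| ≤ |g x| + |m| := abs_sub _ _
      _ ≤ K + K := add_le_add (hK x) hmK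
      _ = 2 * K := by ring
  have h0' : ∫ x, (g x - m) ∂ν = 0 := by
    rw [integral_sub hgi (integrable_const m), integral_const]; simp [hm]
  have hvar : Var[fun x => g x - m; ν] = Var[g; ν] := by
    simp_rw [sub_eq_add_neg]; exact variance_add_const hgi.aestronglyMeasurable (-m)
  have h := tiltPi_meanAccept_tendsto_one (ν := ν) (hgm.sub_const m) hK' h0' (by rwa [hvar]) hβ0 hβ
  refine h.congr fun n => ?_
  exact tiltPi_meanAccept_sub_const m (β n) n

/-- **THE TRANSFER WINDOW OF A PERFECTLY TRAINED FACTORISED FLOW IS `Θ(V^{−1/2})` (above)**: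
proposal `ν_{β₀}^{⊗V}` (`ν_{β₀} = ν.tilted(β₀ g)`), coupling offsets `δ_V` with `δ_V√V → ∞` ⇒ the
transfer acceptance `→ 0` (non-degenerate block: `Var_{ν_{β₀}} g ≠ 0`). [ours] -/
theorem tiltedPi_transfer_tendsto_zero (hgm : Measurable g) {K : ℝ} (hK : ∀ x, |g x| ≤ K) (β₀ : ℝ)
    (hσ : Var[g; ν.tilted fun x => β₀ * g x] ≠ 0) {δ : ℕ → ℝ}
    (hδ : Tendsto (fun n : ℕ => δ n * Real.sqrt n) atTop atTop) :
    Tendsto (fun n : ℕ =>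
        (∫ x, ∫ y, min (Real.exp (δ n * ∑ i, g (x i))) (Real.exp (δ n * ∑ i, g (y i)))
            ∂(Measure.pi fun _ : Fin n => ν.tilted fun x => β₀ * g x)
            ∂(Measure.pi fun _ : Fin n => ν.tilted fun x => β₀ * g x))
          / ∫ x, Real.exp (δ n * ∑ i, g (x i)) ∂(Measure.pi fun _ : Fin n => ν.tilted fun x => β₀ * g x))
      atTop (𝓝 0) := by
  have hgb : ∀ᵐ x ∂ν, g x ∈ Set.Icc (-K) K := ae_of_all _ fun x => abs_le.1 (hK x)
  haveI : IsProbabilityMeasure (ν.tilted fun x => β₀ * g x) :=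
    isProbabilityMeasure_tilted (integrable_exp_mul_of_mem_Icc hgm.aemeasurable hgb)
  exact tiltPi_meanAccept_tendsto_zero_of_bounded hgm hK hσ hδ

/-- **THE TRANSFER WINDOW (below)**: `δ_V ≥ 0`, `δ_V√V → 0` ⇒ the transfer acceptance `→ 1`. [ours] -/
theorem tiltedPi_transfer_tendsto_one (hgm : Measurable g) {K : ℝ} (hK : ∀ x, |g x| ≤ K) (β₀ : ℝ)
    (hσ : Var[g; ν.tilted fun x => β₀ * g x] ≠ 0) {δ : ℕ → ℝ} (hδ0 : ∀ n, 0 ≤ δ n)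
    (hδ : Tendsto (fun n : ℕ => δ n * Real.sqrt n) atTop (𝓝 0)) :
    Tendsto (fun n : ℕ =>
        (∫ x, ∫ y, min (Real.exp (δ n * ∑ i, g (x i))) (Real.exp (δ n * ∑ i, g (y i)))
            ∂(Measure.pi fun _ : Fin n => ν.tilted fun x => β₀ * g x)
            ∂(Measure.pi fun _ : Fin n => ν.tilted fun x => β₀ * g x))
          / ∫ x, Real.exp (δ n * ∑ i, g (x i)) ∂(Measure.pi fun _ : Fin n => ν.tilted fun x => β₀ * g x))
      atTop (𝓝 1) := by
  have hgb : ∀ᵐ x ∂ν, g x ∈ Set.Icc (-K) K := ae_of_all _ fun x => abs_le.1 (hK x)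
  haveI : IsProbabilityMeasure (ν.tilted fun x => β₀ * g x) :=
    isProbabilityMeasure_tilted (integrable_exp_mul_of_mem_Icc hgm.aemeasurable hgb)
  exact tiltPi_meanAccept_tendsto_one_of_bounded hgm hK hσ hδ0 hδ

end TransferWindow

end Summit.Ventures.LatticeQCDFlow.Theory2

end
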